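import Summits.QuantumFields.BalabanUV.Beta.GAN24.WardResidualParity
import Summits.QuantumFields.BalabanUV.Beta.GAN24.KernelLegCharges

/-!
# `BalabanUV.Beta.GAN24.ResidualChargeLegAntisymm` — binder row G-an2-4 ∕ (CONV-C), row (C) at the levels `j ≥ 1`, CONTACT side, the table-law route (TL)
# (leaf-06 g52's memo `C-LEVELS-GE1.md` §12: «the ONE open statement for the contact side is the RESIDUAL's ZERO MODE … which the tree DISPLAYS AND DOES NOT
# VALUE»; my RESULT R-leaf02-g64-1): **THE FIELD–FIELD LEG CHARGE OF THE SANDWICHED WARD-LOCUS RESIDUAL `mmRead Lc (G_j ∘ 𝒩 ∘ G_j)` IS ANTISYMMETRIC UNDER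
# THE EXCHANGE OF THE TWO LEG FIBRES** — it vanishes on the diagonal and drops out of every leg-symmetrised (even-half) charge

NOT IN PRINT; OUR BOOKKEEPING (G-an2-4 crux team (2), leaf prover `b2b-balaban-gan24-formalise-leaf-02`, gen 64; journal RESULT [LEAF02-G64-R1] ∕ INTENT
I-leaf02-g64-4).  WHY.  On the table-law route the background-pair contact sector of the comb member is valued by the index-slot site law of `T̃_{j+1}`
(`WardLocusQuarticWall.divV_e4OfKW_wall` ∕ an2 g48's `WardLocusQuarticSite`), whose displayed residual is `−Σ_{y₀} lam y₀ • mmRead Lc (G_j ∘ 𝒩 y₀ ν y′ ∘ G_j)` with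
`𝒩` the residual of the carrier's law `hWd`; read against CONSTANT legs and INDEX-slot weights, its contribution to the charge of pattern `(κ,κ′;α,β)` is a
weighted sum of the double leg sums `Σ'_x Σ'_z (mmRead Lc (G_j∘𝒩∘G_j)) x z (inl α) (inl β)`.  p2 g44's `WardResidualParity` proved the residual of record
ROW-PARITY-ODD (`trK 𝒩 = −sgnK 𝒩`), hence (d1-leaf-05's `parityOdd_sandwich` over an2's sgn-symmetric `G_j`, `parityOdd_mmRead`) the sandwiched read-out is
TRANSPOSE-ANTISYMMETRIC on the field–field block; exchanging the two leg series (legitimate: `G_j ∘ 𝒩 ∘ G_j` is `Loc`) the double leg sum is ANTISYMMETRIC in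
`(α, β)`.  So: on the Wilson-charged diagonal-leg patterns (`α = β`) the residual contributes NOTHING to the contact sector, and for `α ≠ β` it contributes a
leg-antisymmetric charge, invisible to the even half `½(T + P T)` whose charges are leg-symmetrised (the OWNER's `ZeroModeParity.zmode_sgnK_trK_inl_inl`) —
the residual zero modes of (TL) never need VALUING for (C)^{ev} on the background slots.  (The LEG-pair sector's kernel-leg letter — an2's OFFER
`KernelLegPullback` — meets the FIELD-leg law of `WrecAt j`; its residual is to be read the same way; not here.)

WHAT (generic `d`, in-block root `toSite r`, every level `j`, `G_j := coDressKBmAt (toSite r) Lc (KInvStep Lc j)`; any `Loc 𝒩` with `trK 𝒩 = −sgnK 𝒩` — the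
literal's residual is such by `WardResidualParity.parityOdd_residual_tower_literal`; [folklore] one exchange of two absolutely convergent series; 0 `def`, 0 cited
facts, 0 `def … : Prop`, 0 sorry):
* §1 `tsum_tsum_eq_neg_swap` (`trK A = −A`, summable slice ⟹ `Σ'_x Σ'_z A x z a b = −Σ'_x Σ'_z A x z b a`), `tsum_tsum_diag_eq_zero` (`… a a = 0`).
* §2 `trK_mmRead_sandwich_eq_neg` (`trK (mmRead Lc (G_j∘𝒩∘G_j)) = −mmRead Lc (G_j∘𝒩∘G_j)`), `summable_mmRead_sandwich` (its slices are summable on the product: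
  `Spr.comp_loc` ⨾ `Loc.comp_spr` ⨾ leaf-10's `summable_prod_of_biLoc`, the `Lc`-dilation of the legs being injective), **`residual_legCharge_antisymm`**
  (`Σ'_x Σ'_z (mmRead Lc (G_j∘𝒩∘G_j)) x z (inl α) (inl β) = −(… (inl β) (inl α))`), **`residual_legCharge_diag_eq_zero`**, and the site law's weighted shape
  **`weighted_residual_legCharge_antisymm`** (`Σ_{y₀∈T} lam y₀ · Σ'_x Σ'_z …`).
HONEST FRAMING (cell contract, verbatim): «discharging `BetaPertH` makes Bałaban's UV stability UNCONDITIONAL — a real constructive-QFT result; it is NOT the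
continuum limit and NOT the Clay problem.»  HONEST DEPENDENCY (verbatim): «continuum YM on T⁴ ⇐ BetaPertH ∧ nine spine estimates (0/9 proved); BetaPertH ⇐ (D1) ∧
(D4) ∧ CAP+tail; G-an2-4 gates asym, D1 and NE2/3/4.»  Asserts NO value of any table and NO vanishing of any off-diagonal residual charge; discharges NOTHING of
(C) ∕ (C)sym ∕ (Q-R) ∕ (Q-L) ∕ «T2Shape» ∕ «T2Drift» ∕ (hW, hWall); NEVER «G-an2-4 closed» as (CONV-C); NOT D1, NOT BetaPertH, NOT continuum, NOT Clay.  2026-08-23.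
-/

noncomputable section

open Finset
open scoped BigOperators
open Literature.MathematicalPhysics.QuantumFieldTheory
open Literature.MathematicalPhysics.QuantumFieldTheory.Balaban1983to89
open Literature.MathematicalPhysics.QuantumFieldTheory.Balaban1983to89.Beta
open ExpKernelCalculus (MKer comp)
open AffineAveraging (Site box toSite)
open OneStepResolventKernel (Fib)
open OneStepKernelFamily (KInvStep)
open InterLevelTransport (sublattice_injective)
open BalabanStepJetsSucc (mmRead mmRead_inl_inl)
open Summit.QuantumFields.BalabanUV.Beta.TameKernelCalculus
open Summit.QuantumFields.BalabanUV.Beta.BorderedHessian (sgnK)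
open Summit.QuantumFields.BalabanUV.Beta.AxialDressingRooted (coDressKBmAt decays_coDressKBmAt_KInvStep)
open Summit.QuantumFields.BalabanUV.Beta.SpineRecursiveParity (parityOdd_sandwich parityOdd_mmRead)
open Summit.QuantumFields.BalabanUV.Beta.BubbleParity (trK_coDressKBmAt_KInvStep spr_of_decays)
open Summit.QuantumFields.BalabanUV.Beta.GAN24.WardResidualParity (trK_mmRead_eq_neg_of_parityOdd)
open Summit.QuantumFields.BalabanUV.Beta.GAN24.KernelLegCharges (summable_prod_of_biLoc)

namespace Summit.QuantumFields.BalabanUV.Beta.GAN24.ResidualChargeLegAntisymm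

variable {d : ℕ} {Lc : ℕ} [NeZero Lc] {r : Fin (d + 1) → ℕ}

/-! ## §1 A transpose-antisymmetric kernel has a leg-antisymmetric double leg sum -/

/-- [folklore] **THE DOUBLE LEG SUM OF A TRANSPOSE-ANTISYMMETRIC KERNEL IS ANTISYMMETRIC IN THE FIBRE PAIR**: if `trK A = −A` (`A z x b a = −A x z a b`) and the
`(a,b)`-slice of `A` is summable on the product lattice, then `Σ'_x Σ'_z A x z a b = −Σ'_x Σ'_z A x z b a` (one exchange of the two series). -/
theorem tsum_tsum_eq_neg_swap {A : MKer (d + 1) (Fib d)} (hA : trK A = -A) (a b : Fib d)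
    (hs : Summable fun xz : Site (d + 1) × Site (d + 1) => A xz.1 xz.2 a b) :
    ∑' x : Site (d + 1), ∑' z : Site (d + 1), A x z a b = -∑' x : Site (d + 1), ∑' z : Site (d + 1), A x z b a := by
  have hpt : ∀ x z : Site (d + 1), A x z a b = -A z x b a := fun x z => by
    have h := congrFun (congrFun (congrFun (congrFun hA z) x) b) a
    simp only [trK_apply, Pi.neg_apply] at h
    linarith
  have hs' : Summable (Function.uncurry fun z x : Site (d + 1) => A z x b a) := by
    refine ((hs.comp_injective (Equiv.prodComm (Site (d + 1)) (Site (d + 1))).injective).neg).congr fun xz => ?_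
    show -A xz.2 xz.1 a b = A xz.1 xz.2 b a
    rw [hpt xz.2 xz.1, neg_neg]
  calc ∑' x : Site (d + 1), ∑' z : Site (d + 1), A x z a b
      = ∑' x : Site (d + 1), ∑' z : Site (d + 1), -A z x b a := by simp_rw [hpt]
    _ = -∑' x : Site (d + 1), ∑' z : Site (d + 1), A z x b a := by simp_rw [tsum_neg]
    _ = -∑' z : Site (d + 1), ∑' x : Site (d + 1), A z x b a := by rw [hs'.tsum_comm]

/-- [folklore] In particular the DIAGONAL leg charge of a transpose-antisymmetric kernel vanishes: `Σ'_x Σ'_z A x z a a = 0`. -/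
theorem tsum_tsum_diag_eq_zero {A : MKer (d + 1) (Fib d)} (hA : trK A = -A) (a : Fib d)
    (hs : Summable fun xz : Site (d + 1) × Site (d + 1) => A xz.1 xz.2 a a) :
    ∑' x : Site (d + 1), ∑' z : Site (d + 1), A x z a a = 0 := by
  have h := tsum_tsum_eq_neg_swap hA a a hs
  linarith

/-! ## §2 The sandwiched residual `mmRead Lc (G_j ∘ 𝒩 ∘ G_j)` of a parity-odd localised `𝒩` -/

/-- [folklore] **THE SANDWICHED READ-OUT OF A PARITY-ODD LOCALISED KERNEL IS TRANSPOSE-ANTISYMMETRIC** (in-block root; every level `j`): for `Loc 𝒩` with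
`trK 𝒩 = −sgnK 𝒩`, `trK (mmRead Lc (G_j ∘ 𝒩 ∘ G_j)) = −mmRead Lc (G_j ∘ 𝒩 ∘ G_j)`, `G_j = coDressKBmAt (toSite r) Lc (KInvStep Lc j)` (p2 g44's route BY NAME:
d1-leaf-05's `parityOdd_sandwich` over an2's `trK_coDressKBmAt_KInvStep`, then `parityOdd_mmRead` and `WardResidualParity.trK_mmRead_eq_neg_of_parityOdd`). -/
theorem trK_mmRead_sandwich_eq_neg (hr : r ∈ box (d + 1) Lc) (j : ℕ) {𝒩 : MKer (d + 1) (Fib d)} (h𝒩 : Loc 𝒩) (hpar : trK 𝒩 = -sgnK 𝒩) :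
    trK (mmRead Lc (comp (comp (coDressKBmAt (toSite r) Lc (KInvStep (d := d) Lc j)) 𝒩) (coDressKBmAt (toSite r) Lc (KInvStep (d := d) Lc j))))
      = -mmRead Lc (comp (comp (coDressKBmAt (toSite r) Lc (KInvStep (d := d) Lc j)) 𝒩) (coDressKBmAt (toSite r) Lc (KInvStep (d := d) Lc j))) :=
  trK_mmRead_eq_neg_of_parityOdd Lc (parityOdd_mmRead Lc
    (parityOdd_sandwich (spr_of_decays (decays_coDressKBmAt_KInvStep (d := d) hr j)) h𝒩 (trK_coDressKBmAt_KInvStep hr j) hpar))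

/-- [folklore] The field–field slices of the sandwiched read-out are summable on the product lattice (`G_j ∘ 𝒩 ∘ G_j` is `Loc`: `Spr.comp_loc`, `Loc.comp_spr`;
leaf-10's `summable_prod_of_biLoc`; the `Lc`-dilation of both legs is injective). -/
theorem summable_mmRead_sandwich (hr : r ∈ box (d + 1) Lc) (j : ℕ) {𝒩 : MKer (d + 1) (Fib d)} (h𝒩 : Loc 𝒩) (a b : Fib d) :
    Summable fun xz : Site (d + 1) × Site (d + 1) =>
      mmRead Lc (comp (comp (coDressKBmAt (toSite r) Lc (KInvStep (d := d) Lc j)) 𝒩) (coDressKBmAt (toSite r) Lc (KInvStep (d := d) Lc j))) xz.1 xz.2 a b := by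
  have hG : Spr (coDressKBmAt (toSite r) Lc (KInvStep (d := d) Lc j)) := spr_of_decays (decays_coDressKBmAt_KInvStep (d := d) hr j)
  obtain ⟨p, q, C, δ, hδ, hB⟩ := (hG.comp_loc h𝒩).comp_spr hG
  rcases a with α | μ
  · rcases b with β | ν
    · have hs := summable_prod_of_biLoc hB hδ (Sum.inr α) (Sum.inr β)
      have hinj : Function.Injective (fun xz : Site (d + 1) × Site (d + 1) => (((Lc : ℤ) • xz.1 : Site (d + 1)), ((Lc : ℤ) • xz.2 : Site (d + 1)))) := by
        intro xz xz' h
        simp only [Prod.mk.injEq] at h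
        have h1 := sublattice_injective (d := d) Lc 0 (a₁ := xz.1) (a₂ := xz'.1) (by simpa using h.1)
        have h2 := sublattice_injective (d := d) Lc 0 (a₁ := xz.2) (a₂ := xz'.2) (by simpa using h.2)
        exact Prod.ext h1 h2
      refine (hs.comp_injective hinj).congr fun xz => ?_
      simp only [Function.comp_apply, mmRead_inl_inl]
    · simp only [BalabanStepJetsSucc.mmRead_inr_right]; exact summable_zero
  · simp only [BalabanStepJetsSucc.mmRead_inr_left]; exact summable_zero

/-- NOT IN PRINT; OUR BOOKKEEPING.  **THE RESIDUAL's FIELD–FIELD LEG CHARGE IS ANTISYMMETRIC IN THE FIBRE PAIR** (in-block root, every level `j`, every parity-odd `Loc 𝒩` —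
at the literal of record the `hWd` residual `𝒩 = vertexOfK G_j (Φ_j y) ν y′ + Ψ_j y ν y′` IS parity-odd by p2 g44's `WardResidualParity.parityOdd_residual_tower_literal`):
`Σ'_x Σ'_z (mmRead Lc (G_j ∘ 𝒩 ∘ G_j)) x z (inl α) (inl β) = −Σ'_x Σ'_z (mmRead Lc (G_j ∘ 𝒩 ∘ G_j)) x z (inl β) (inl α)`.  Read through the site law's displayed residual
`Σ_{y₀} lam y₀ • mmRead Lc (G_j ∘ 𝒩 y₀ ∘ G_j)` (`WardLocusQuarticWall.divV_e4OfKW_wall` ∕ an2's `WardLocusQuarticSite`), against CONSTANT legs and INDEX-slot weights: every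
residual zero mode the table-law route of the contact side would have to value is leg-antisymmetric — invisible to the even half's leg-symmetrised charges
(OWNER `ZeroModeParity.zmode_sgnK_trK_inl_inl`) and ZERO on the diagonal-leg (Wilson-charged) patterns. -/
theorem residual_legCharge_antisymm (hr : r ∈ box (d + 1) Lc) (j : ℕ) {𝒩 : MKer (d + 1) (Fib d)} (h𝒩 : Loc 𝒩) (hpar : trK 𝒩 = -sgnK 𝒩) (α β : Fin (d + 1)) :
    ∑' x : Site (d + 1), ∑' z : Site (d + 1),
        mmRead Lc (comp (comp (coDressKBmAt (toSite r) Lc (KInvStep (d := d) Lc j)) 𝒩) (coDressKBmAt (toSite r) Lc (KInvStep (d := d) Lc j))) x z (Sum.inl α) (Sum.inl β)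
      = -∑' x : Site (d + 1), ∑' z : Site (d + 1),
        mmRead Lc (comp (comp (coDressKBmAt (toSite r) Lc (KInvStep (d := d) Lc j)) 𝒩) (coDressKBmAt (toSite r) Lc (KInvStep (d := d) Lc j))) x z (Sum.inl β) (Sum.inl α) :=
  tsum_tsum_eq_neg_swap (trK_mmRead_sandwich_eq_neg hr j h𝒩 hpar) _ _ (summable_mmRead_sandwich hr j h𝒩 _ _)

/-- NOT IN PRINT; OUR BOOKKEEPING.  **… AND VANISHES ON THE DIAGONAL**: `Σ'_x Σ'_z (mmRead Lc (G_j ∘ 𝒩 ∘ G_j)) x z (inl α) (inl α) = 0`. -/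
theorem residual_legCharge_diag_eq_zero (hr : r ∈ box (d + 1) Lc) (j : ℕ) {𝒩 : MKer (d + 1) (Fib d)} (h𝒩 : Loc 𝒩) (hpar : trK 𝒩 = -sgnK 𝒩) (α : Fin (d + 1)) :
    ∑' x : Site (d + 1), ∑' z : Site (d + 1),
        mmRead Lc (comp (comp (coDressKBmAt (toSite r) Lc (KInvStep (d := d) Lc j)) 𝒩) (coDressKBmAt (toSite r) Lc (KInvStep (d := d) Lc j))) x z (Sum.inl α) (Sum.inl α)
      = 0 :=
  tsum_tsum_diag_eq_zero (trK_mmRead_sandwich_eq_neg hr j h𝒩 hpar) _ (summable_mmRead_sandwich hr j h𝒩 _ _)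

/-- NOT IN PRINT; OUR BOOKKEEPING.  **A WEIGHTED FINITE FAMILY OF RESIDUALS**: for sites `y₀ ∈ T` with weights `lam` and parity-odd localised `𝒩 y₀`, the weighted residual's
diagonal leg charge vanishes and its off-diagonal leg charge is antisymmetric — the shape of the site law's displayed residual `Σ_{y₀∈T} lam y₀ • mmRead Lc (G_j∘𝒩 y₀∘G_j)`. -/
theorem weighted_residual_legCharge_antisymm (hr : r ∈ box (d + 1) Lc) (j : ℕ) {ι : Type*} (T : Finset ι) (lam : ι → ℝ)
    {𝒩 : ι → MKer (d + 1) (Fib d)} (h𝒩 : ∀ i, Loc (𝒩 i)) (hpar : ∀ i, trK (𝒩 i) = -sgnK (𝒩 i)) (α β : Fin (d + 1)) :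
    ∑ i ∈ T, lam i * ∑' x : Site (d + 1), ∑' z : Site (d + 1),
        mmRead Lc (comp (comp (coDressKBmAt (toSite r) Lc (KInvStep (d := d) Lc j)) (𝒩 i)) (coDressKBmAt (toSite r) Lc (KInvStep (d := d) Lc j))) x z (Sum.inl α) (Sum.inl β)
      = -∑ i ∈ T, lam i * ∑' x : Site (d + 1), ∑' z : Site (d + 1),
        mmRead Lc (comp (comp (coDressKBmAt (toSite r) Lc (KInvStep (d := d) Lc j)) (𝒩 i)) (coDressKBmAt (toSite r) Lc (KInvStep (d := d) Lc j))) x z (Sum.inl β) (Sum.inl α) := by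
  rw [← Finset.sum_neg_distrib]
  refine Finset.sum_congr rfl fun i _ => ?_
  rw [residual_legCharge_antisymm hr j (h𝒩 i) (hpar i) α β, mul_neg]

/-- NOT IN PRINT; OUR BOOKKEEPING.  **THE DOUBLY-WEIGHTED FORM** (leaf-06 g52's WANTED W-2 signature: weights `w r y₀` on the two INDEX slots, parity-odd localised
`𝒩 y₀ r`): `Σ_{r∈R} Σ_{y₀∈T} w r y₀ · Σ'_x Σ'_z (mmRead Lc (G_j ∘ 𝒩 y₀ r ∘ G_j)) x z (inl α) (inl β)` is ANTISYMMETRIC in `(α, β)` — the background-pair contact sector's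
residual charge; `= 0` on the diagonal `α = β` by `residual_legCharge_diag_eq_zero` termwise. -/
theorem weighted₂_residual_legCharge_antisymm (hr : r ∈ box (d + 1) Lc) (j : ℕ) {ι₁ ι₂ : Type*} (R : Finset ι₁) (T : Finset ι₂) (w : ι₁ → ι₂ → ℝ)
    {𝒩 : ι₂ → ι₁ → MKer (d + 1) (Fib d)} (h𝒩 : ∀ i₂ i₁, Loc (𝒩 i₂ i₁)) (hpar : ∀ i₂ i₁, trK (𝒩 i₂ i₁) = -sgnK (𝒩 i₂ i₁)) (α β : Fin (d + 1)) :
    ∑ i₁ ∈ R, ∑ i₂ ∈ T, w i₁ i₂ * ∑' x : Site (d + 1), ∑' z : Site (d + 1),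
        mmRead Lc (comp (comp (coDressKBmAt (toSite r) Lc (KInvStep (d := d) Lc j)) (𝒩 i₂ i₁)) (coDressKBmAt (toSite r) Lc (KInvStep (d := d) Lc j))) x z
          (Sum.inl α) (Sum.inl β)
      = -∑ i₁ ∈ R, ∑ i₂ ∈ T, w i₁ i₂ * ∑' x : Site (d + 1), ∑' z : Site (d + 1),
        mmRead Lc (comp (comp (coDressKBmAt (toSite r) Lc (KInvStep (d := d) Lc j)) (𝒩 i₂ i₁)) (coDressKBmAt (toSite r) Lc (KInvStep (d := d) Lc j))) x z
          (Sum.inl β) (Sum.inl α) := by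
  rw [← Finset.sum_neg_distrib]
  refine Finset.sum_congr rfl fun i₁ _ => ?_
  exact weighted_residual_legCharge_antisymm hr j T (w i₁) (fun i₂ => h𝒩 i₂ i₁) (fun i₂ => hpar i₂ i₁) α β

/-- NOT IN PRINT; OUR BOOKKEEPING.  … and its DIAGONAL vanishes: `Σ_{r∈R} Σ_{y₀∈T} w r y₀ · Σ'_x Σ'_z (mmRead Lc (G_j ∘ 𝒩 y₀ r ∘ G_j)) x z (inl α) (inl α) = 0`. -/
theorem weighted₂_residual_legCharge_diag_eq_zero (hr : r ∈ box (d + 1) Lc) (j : ℕ) {ι₁ ι₂ : Type*} (R : Finset ι₁) (T : Finset ι₂) (w : ι₁ → ι₂ → ℝ)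
    {𝒩 : ι₂ → ι₁ → MKer (d + 1) (Fib d)} (h𝒩 : ∀ i₂ i₁, Loc (𝒩 i₂ i₁)) (hpar : ∀ i₂ i₁, trK (𝒩 i₂ i₁) = -sgnK (𝒩 i₂ i₁)) (α : Fin (d + 1)) :
    ∑ i₁ ∈ R, ∑ i₂ ∈ T, w i₁ i₂ * ∑' x : Site (d + 1), ∑' z : Site (d + 1),
        mmRead Lc (comp (comp (coDressKBmAt (toSite r) Lc (KInvStep (d := d) Lc j)) (𝒩 i₂ i₁)) (coDressKBmAt (toSite r) Lc (KInvStep (d := d) Lc j))) x z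
          (Sum.inl α) (Sum.inl α) = 0 := by
  refine Finset.sum_eq_zero fun i₁ _ => Finset.sum_eq_zero fun i₂ _ => ?_
  rw [residual_legCharge_diag_eq_zero hr j (h𝒩 i₂ i₁) (hpar i₂ i₁) α, mul_zero]

end Summit.QuantumFields.BalabanUV.Beta.GAN24.ResidualChargeLegAntisymm
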